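import Literature.MathematicalPhysics.QuantumFieldTheory.PlaqSystemReplica
import HarnessLib

/-!
# The replica formula for truncated correlations of a general plaquette system

Sequel of `PlaqSystemReplica` (support for `UniformTorusClustering`; Osterwalder–Seiler,
Ann. Phys. 110 (1978) 440, §3, periodic rendering). For an abstract plaquette system
`S : PlaqSystem d G ι` and bounded measurable bond-local observables `F₁, F₂`:

* the **replica formula** `Z_V N_V(F₁F₂) − N_V(F₁) N_V(F₂) = ½ ∫ ΔF₁ ΔF₂ w(U) w(U')`,
  `w = ∏_{p ∈ V} (1 + f_p)`, `ΔF = F(U) − F(U')` (`partZ_mul_numZ_sub_eq_integral`: independence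
  of the replicas and the global swap symmetry);
* its expansion `= ½ ∑_{Q ⊆ V, Q joins B₁ to B₂} ∫ ΔF₁ ΔF₂ g_Q` over the polymers joining the two
  (disjoint) supports (`partZ_mul_numZ_sub_eq_sum`: `w(U)w(U') = ∑_Q g_Q` and the vanishing of
  the non-joining terms, `PlaqSystem.integral_trunc_dblWeightProd_eq_zero`).

Everything is proved; no named facts.

## References

* K. Osterwalder, E. Seiler, Ann. Phys. 110 (1978) 440–471, §3 [OsterwalderSeilerAnnPhys1978].
* E. Seiler, LNP 159 (1982), Ch. 2–3 [SeilerLNP1982].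
-/

namespace Literature.MathematicalPhysics.QuantumFieldTheory

open MeasureTheory Measure ProbabilityTheory Finset Filter
open scoped Topology

noncomputable section

namespace PlaqSystem

variable {d : ℕ} {G : Type*} {ι : Type*} (S : PlaqSystem d G ι)

/-! ### The replica formula -/

section Replica

variable {S} [Group G] [TopologicalSpace G] [IsTopologicalGroup G] [CompactSpace G]
  [MeasurableSpace G] [BorelSpace G] {M : ℝ} {D : ℕ}

omit [Group G] [TopologicalSpace G] [IsTopologicalGroup G] [CompactSpace G]
  [MeasurableSpace G] [BorelSpace G] in
/-- `w = ∏_{p ∈ V} (1 + f_p)` depends only on the bonds of `V`. [folklore] -/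
theorem dependsOn_prod_one_add_weight (β : ℂ) (V : Finset ι) :
    DependsOn (fun U : ZdGaugeConfig d G => ∏ p ∈ V, (1 + S.weight β p U))
      ((V.biUnion S.bonds : Finset (ZdEdge d)) : Set (ZdEdge d)) := by
  intro U U' h
  refine Finset.prod_congr rfl fun p hp => ?_
  rw [S.dependsOn_weight β p fun e he => h e
    (Finset.mem_coe.2 (Finset.mem_biUnion.2 ⟨p, hp, Finset.mem_coe.1 he⟩))]

omit [Group G] [TopologicalSpace G] [IsTopologicalGroup G] [CompactSpace G]
  [BorelSpace G] in
/-- `‖w‖ ≤ (e^{‖β‖M} + 2)^{|V|}`. [folklore] -/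
theorem norm_prod_one_add_weight_le (hR : S.Regular M D) (β : ℂ) (V : Finset ι)
    (U : ZdGaugeConfig d G) :
    ‖∏ p ∈ V, (1 + S.weight β p U)‖ ≤ (Real.exp (‖β‖ * M) + 2) ^ V.card := by
  refine (Finset.norm_prod_le _ _).trans ?_
  rw [← Finset.prod_const]
  refine Finset.prod_le_prod (fun _ _ => norm_nonneg _) fun p _ => ?_
  calc ‖1 + S.weight β p U‖ ≤ ‖(1 : ℂ)‖ + ‖S.weight β p U‖ := norm_add_le _ _
    _ ≤ 1 + (Real.exp (‖β‖ * M) + 1) := add_le_add (by simp) (norm_weight_le_crude hR β p U)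
    _ = Real.exp (‖β‖ * M) + 2 := by ring

/-- **The replica formula.** For bounded measurable bond-local `F₁, F₂`:
`Z_V · N_V(F₁ F₂) − N_V(F₁) · N_V(F₂) = ½ ∫ (F₁(U) − F₁(U'))(F₂(U) − F₂(U')) w(U) w(U')`,
`w = ∏_{p ∈ V}(1 + f_p)` (independence of the replicas and the global swap symmetry). [folklore] -/
theorem partZ_mul_numZ_sub_eq_integral (hR : S.Regular M D) {B₁ B₂ : Finset (ZdEdge d)}
    {F₁ F₂ : ZdGaugeConfig d G → ℂ} (h₁m : Measurable F₁) (h₂m : Measurable F₂) {C₁ C₂ : ℝ}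
    (h₁b : ∀ U, ‖F₁ U‖ ≤ C₁) (h₂b : ∀ U, ‖F₂ U‖ ≤ C₂)
    (hF₁ : DependsOn F₁ (B₁ : Set (ZdEdge d))) (hF₂ : DependsOn F₂ (B₂ : Set (ZdEdge d)))
    (V : Finset ι) (β : ℂ) :
    S.partZ V β * S.numZ (fun U => F₁ U * F₂ U) V β - S.numZ F₁ V β * S.numZ F₂ V β =
      (1 / 2 : ℂ) * ∫ W, (F₁ W.fst - F₁ W.snd) * (F₂ W.fst - F₂ W.snd) *
        ((∏ p ∈ V, (1 + S.weight β p W.fst)) * ∏ p ∈ V, (1 + S.weight β p W.snd)) ∂dblHaar d G := by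
  classical
  set w : ZdGaugeConfig d G → ℂ := fun U => ∏ p ∈ V, (1 + S.weight β p U) with hw
  have hwm : Measurable w := measurable_prod_one_add_weight hR β V
  have hwdep : DependsOn w ((V.biUnion S.bonds : Finset (ZdEdge d)) : Set (ZdEdge d)) :=
    dependsOn_prod_one_add_weight (S := S) β V
  set K : ℝ := (Real.exp (‖β‖ * M) + 2) ^ V.card with hK
  have hwb : ∀ U, ‖w U‖ ≤ K := fun U => norm_prod_one_add_weight_le hR β V U
  have hC₁ : 0 ≤ C₁ := (norm_nonneg _).trans (h₁b fun _ => 1)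
  have hC₂ : 0 ≤ C₂ := (norm_nonneg _).trans (h₂b fun _ => 1)
  -- the four bond-local factors
  have hd12w : DependsOn (fun U => F₁ U * F₂ U * w U)
      (((B₁ ∪ B₂) ∪ V.biUnion S.bonds : Finset (ZdEdge d)) : Set (ZdEdge d)) := by
    intro U U' h
    simp only [Finset.coe_union] at h
    show F₁ U * F₂ U * w U = F₁ U' * F₂ U' * w U'
    rw [hF₁ fun e he => h e (Or.inl (Or.inl he)), hF₂ fun e he => h e (Or.inl (Or.inr he)),
      hwdep fun e he => h e (Or.inr he)]
  have hd1w : DependsOn (fun U => F₁ U * w U)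
      ((B₁ ∪ V.biUnion S.bonds : Finset (ZdEdge d)) : Set (ZdEdge d)) := by
    intro U U' h
    simp only [Finset.coe_union] at h
    show F₁ U * w U = F₁ U' * w U'
    rw [hF₁ fun e he => h e (Or.inl he), hwdep fun e he => h e (Or.inr he)]
  have hd2w : DependsOn (fun U => F₂ U * w U)
      ((B₂ ∪ V.biUnion S.bonds : Finset (ZdEdge d)) : Set (ZdEdge d)) := by
    intro U U' h
    simp only [Finset.coe_union] at h
    show F₂ U * w U = F₂ U' * w U'
    rw [hF₂ fun e he => h e (Or.inl he), hwdep fun e he => h e (Or.inr he)]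
  -- the two products of integrals as doubled integrals
  have e1 : S.partZ V β * S.numZ (fun U => F₁ U * F₂ U) V β =
      ∫ W, (F₁ W.fst * F₂ W.fst * w W.fst) * w W.snd ∂dblHaar d G := by
    have h := integral_fst_mul_snd_dblHaarC (A := fun U => F₁ U * F₂ U * w U) (B := w)
      ((h₁m.mul h₂m).mul hwm) hwm hd12w hwdep
    rw [mul_comm, PlaqSystem.partZ_eq]
    exact h.symm
  have e2 : S.numZ F₁ V β * S.numZ F₂ V β =
      ∫ W, (F₁ W.fst * w W.fst) * (F₂ W.snd * w W.snd) ∂dblHaar d G := by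
    have h := integral_fst_mul_snd_dblHaarC (A := fun U => F₁ U * w U) (B := fun U => F₂ U * w U)
      (h₁m.mul hwm) (h₂m.mul hwm) hd1w hd2w
    exact h.symm
  -- integrability on the doubled space
  have hIbound : ∀ {Φ : DblConfig d G → ℂ}, Measurable Φ → ∀ C, (∀ W, ‖Φ W‖ ≤ C) →
      Integrable Φ (dblHaar d G) := fun hm C hC =>
    Integrable.of_bound hm.aestronglyMeasurable C (Eventually.of_forall hC)
  have m1 : Measurable fun W : DblConfig d G => F₁ W.fst := h₁m.comp DblConfig.measurable_fst
  have m1' : Measurable fun W : DblConfig d G => F₁ W.snd := h₁m.comp DblConfig.measurable_snd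
  have m2 : Measurable fun W : DblConfig d G => F₂ W.fst := h₂m.comp DblConfig.measurable_fst
  have m2' : Measurable fun W : DblConfig d G => F₂ W.snd := h₂m.comp DblConfig.measurable_snd
  have mw : Measurable fun W : DblConfig d G => w W.fst := hwm.comp DblConfig.measurable_fst
  have mw' : Measurable fun W : DblConfig d G => w W.snd := hwm.comp DblConfig.measurable_snd
  set Ψ : DblConfig d G → ℂ := fun W =>
    (F₁ W.fst * F₂ W.fst - F₁ W.fst * F₂ W.snd) * (w W.fst * w W.snd) with hΨ
  have hΨm : Measurable Ψ := ((m1.mul m2).sub (m1.mul m2')).mul (mw.mul mw')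
  have hΨb : ∀ W, ‖Ψ W‖ ≤ 2 * C₁ * C₂ * (K * K) := by
    intro W
    simp only [hΨ]
    rw [norm_mul, norm_mul]
    have hKK : ‖w W.fst‖ * ‖w W.snd‖ ≤ K * K :=
      mul_le_mul (hwb _) (hwb _) (norm_nonneg _) ((norm_nonneg _).trans (hwb W.fst))
    have hF : ‖F₁ W.fst * F₂ W.fst - F₁ W.fst * F₂ W.snd‖ ≤ 2 * C₁ * C₂ := by
      refine (norm_sub_le _ _).trans ?_
      rw [norm_mul, norm_mul]
      nlinarith [h₁b W.fst, h₂b W.fst, h₂b W.snd, norm_nonneg (F₁ W.fst), norm_nonneg (F₂ W.fst),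
        norm_nonneg (F₂ W.snd)]
    exact mul_le_mul hF hKK (by positivity) (by positivity)
  have hIΨ : Integrable Ψ (dblHaar d G) := hIbound hΨm _ hΨb
  have hIΨs : Integrable (fun W => Ψ (W.swapOn Set.univ)) (dblHaar d G) := by
    refine hIbound (hΨm.comp (measurable_pi_lambda _ fun e => measurable_pi_apply _)) _
      fun W => hΨb _
  -- `LHS = ∫ Ψ = ∫ Ψ ∘ swap = ½ ∫ (Ψ + Ψ ∘ swap)`
  have hI1 : Integrable (fun W : DblConfig d G => F₁ W.fst * F₂ W.fst * w W.fst * w W.snd)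
      (dblHaar d G) := by
    refine hIbound (((m1.mul m2).mul mw).mul mw') (C₁ * C₂ * K * K) fun W => ?_
    rw [norm_mul, norm_mul, norm_mul]
    exact mul_le_mul (mul_le_mul (mul_le_mul (h₁b W.fst) (h₂b W.fst) (norm_nonneg _) hC₁)
      (hwb W.fst) (norm_nonneg _) (by positivity)) (hwb W.snd) (norm_nonneg _) (by positivity)
  have hI2 : Integrable (fun W : DblConfig d G => F₁ W.fst * w W.fst * (F₂ W.snd * w W.snd))
      (dblHaar d G) := by
    refine hIbound ((m1.mul mw).mul (m2'.mul mw')) (C₁ * K * (C₂ * K)) fun W => ?_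
    rw [norm_mul, norm_mul, norm_mul]
    exact mul_le_mul (mul_le_mul (h₁b _) (hwb _) (norm_nonneg _) hC₁)
      (mul_le_mul (h₂b _) (hwb _) (norm_nonneg _) hC₂) (by positivity) (by positivity)
  have hL : S.partZ V β * S.numZ (fun U => F₁ U * F₂ U) V β - S.numZ F₁ V β * S.numZ F₂ V β =
      ∫ W, Ψ W ∂dblHaar d G := by
    rw [e1, e2, ← integral_sub hI1 hI2]
    refine integral_congr_ae (Eventually.of_forall fun W => ?_)
    simp only [hΨ]
    ring
  have hswap : ∀ W : DblConfig d G, Ψ (W.swapOn Set.univ) =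
      (F₁ W.snd * F₂ W.snd - F₁ W.snd * F₂ W.fst) * (w W.fst * w W.snd) := by
    intro W
    have hf : (W.swapOn Set.univ).fst = W.snd := by
      funext e; simp [DblConfig.fst, DblConfig.snd, DblConfig.swapOn]
    have hs : (W.swapOn Set.univ).snd = W.fst := by
      funext e; simp [DblConfig.fst, DblConfig.snd, DblConfig.swapOn]
    simp only [hΨ, hf, hs]
    ring
  have hsym : ∫ W, Ψ W ∂dblHaar d G = ∫ W, Ψ (W.swapOn Set.univ) ∂dblHaar d G :=
    (integral_comp_swapOnC Set.univ hΨm.aestronglyMeasurable).symm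
  rw [hL]
  have h2 : (2 : ℂ) * ∫ W, Ψ W ∂dblHaar d G =
      ∫ W, (F₁ W.fst - F₁ W.snd) * (F₂ W.fst - F₂ W.snd) * (w W.fst * w W.snd) ∂dblHaar d G := by
    rw [two_mul]
    nth_rw 2 [hsym]
    rw [← integral_add hIΨ hIΨs]
    refine integral_congr_ae (Eventually.of_forall fun W => ?_)
    show Ψ W + Ψ (W.swapOn Set.univ) =
      (F₁ W.fst - F₁ W.snd) * (F₂ W.fst - F₂ W.snd) * (w W.fst * w W.snd)
    rw [hswap]
    simp only [hΨ]
    ring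
  rw [← h2]
  ring

open Classical in
/-- **The replica expansion of the truncated numerator over joining polymers.** With the same
hypotheses and `B₁ ∩ B₂ = ∅`:
`Z_V N_V(F₁F₂) − N_V(F₁)N_V(F₂) = ½ ∑_{Q ⊆ V, Q joins B₁ to B₂} ∫ ΔF₁ ΔF₂ g_Q`. [folklore] -/
theorem partZ_mul_numZ_sub_eq_sum (hR : S.Regular M D) {B₁ B₂ : Finset (ZdEdge d)}
    {F₁ F₂ : ZdGaugeConfig d G → ℂ} (h₁m : Measurable F₁) (h₂m : Measurable F₂) {C₁ C₂ : ℝ}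
    (h₁b : ∀ U, ‖F₁ U‖ ≤ C₁) (h₂b : ∀ U, ‖F₂ U‖ ≤ C₂)
    (hF₁ : DependsOn F₁ (B₁ : Set (ZdEdge d))) (hF₂ : DependsOn F₂ (B₂ : Set (ZdEdge d)))
    (hB : Disjoint B₁ B₂) (V : Finset ι) (β : ℂ) :
    S.partZ V β * S.numZ (fun U => F₁ U * F₂ U) V β - S.numZ F₁ V β * S.numZ F₂ V β =
      (1 / 2 : ℂ) * ∑ Q ∈ V.powerset.filter (fun Q => S.Joins Q B₁ B₂),
        ∫ W, (F₁ W.fst - F₁ W.snd) * (F₂ W.fst - F₂ W.snd) * S.dblWeightProd β Q W ∂dblHaar d G := by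
  classical
  rw [partZ_mul_numZ_sub_eq_integral hR h₁m h₂m h₁b h₂b hF₁ hF₂ V β]
  congr 1
  have hβM : 0 ≤ 8 * M * ‖β‖ + (Real.exp (‖β‖ * M) + 2) := by
    have := hR.pos; positivity
  -- termwise integrability
  have htrunc : Measurable fun W : DblConfig d G => (F₁ W.fst - F₁ W.snd) * (F₂ W.fst - F₂ W.snd) :=
    ((h₁m.comp DblConfig.measurable_fst).sub (h₁m.comp DblConfig.measurable_snd)).mul
      ((h₂m.comp DblConfig.measurable_fst).sub (h₂m.comp DblConfig.measurable_snd))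
  have htb : ∀ W : DblConfig d G, ‖(F₁ W.fst - F₁ W.snd) * (F₂ W.fst - F₂ W.snd)‖ ≤
      (C₁ + C₁) * (C₂ + C₂) := fun W => by
    rw [norm_mul]
    exact mul_le_mul ((norm_sub_le _ _).trans (add_le_add (h₁b _) (h₁b _)))
      ((norm_sub_le _ _).trans (add_le_add (h₂b _) (h₂b _))) (norm_nonneg _)
      (by linarith [(norm_nonneg _).trans (h₁b W.fst)])
  have hI : ∀ Q ∈ V.powerset, Integrable (fun W : DblConfig d G =>
      (F₁ W.fst - F₁ W.snd) * (F₂ W.fst - F₂ W.snd) * S.dblWeightProd β Q W) (dblHaar d G) := by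
    intro Q _
    refine Integrable.of_bound ((htrunc.mul (measurable_dblWeightProd hR β Q)).aestronglyMeasurable)
      ((C₁ + C₁) * (C₂ + C₂) * ((Real.exp (‖β‖ * M) + 3) ^ Q.card) ^ 2)
      (Eventually.of_forall fun W => ?_)
    rw [norm_mul]
    have hC₁ : 0 ≤ C₁ := (norm_nonneg _).trans (h₁b W.fst)
    have hC₂ : 0 ≤ C₂ := (norm_nonneg _).trans (h₂b W.fst)
    refine mul_le_mul (htb W) ?_ (norm_nonneg _) (by positivity)
    -- crude bound on `g_Q` through the two products of `1 + f`
    unfold dblWeightProd dblWeight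
    refine (Finset.norm_prod_le _ _).trans ?_
    rw [sq, ← mul_pow, ← Finset.prod_const]
    refine Finset.prod_le_prod (fun _ _ => norm_nonneg _) fun p _ => ?_
    have hf := norm_weight_le_crude hR β p W.fst
    have hs := norm_weight_le_crude hR β p W.snd
    calc ‖(1 + S.weight β p W.fst) * (1 + S.weight β p W.snd) - 1‖
        ≤ ‖(1 + S.weight β p W.fst) * (1 + S.weight β p W.snd)‖ + ‖(1 : ℂ)‖ := norm_sub_le _ _
      _ ≤ (1 + (Real.exp (‖β‖ * M) + 1)) * (1 + (Real.exp (‖β‖ * M) + 1)) + 1 := by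
          rw [norm_mul, norm_one]
          gcongr
          · exact (norm_add_le _ _).trans (by simpa using hf)
          · exact (norm_add_le _ _).trans (by simpa using hs)
      _ ≤ (Real.exp (‖β‖ * M) + 3) * (Real.exp (‖β‖ * M) + 3) := by
          nlinarith [Real.exp_pos (‖β‖ * M)]
  -- expand and drop the non-joining terms
  simp_rw [S.prod_mul_prod_eq_sum_dblWeightProd β V, Finset.mul_sum]
  rw [integral_finsetSum _ hI, ← Finset.sum_filter_add_sum_filter_not V.powerset
    (fun Q => S.Joins Q B₁ B₂)]
  conv_rhs => rw [← add_zero (∑ Q ∈ V.powerset.filter (fun Q => S.Joins Q B₁ B₂), _)]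
  congr 1
  refine Finset.sum_eq_zero fun Q hQ => ?_
  rw [Finset.mem_filter] at hQ
  exact S.integral_trunc_dblWeightProd_eq_zero β hF₁ hF₂
    ((htrunc.mul (measurable_dblWeightProd hR β Q)).aestronglyMeasurable) hQ.2 hB

end Replica

end PlaqSystem

end

end Literature.MathematicalPhysics.QuantumFieldTheory
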